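import Summits.BirchSwinnertonDyer.Rank1Residual.Additive.TameBranchRatCharEqDefectTwoHeadlines
import Summits.BirchSwinnertonDyer.Rank1Residual.Additive.TameBranchRatCharEqDefectTwoX3
import Summits.BirchSwinnertonDyer.Rank1Residual.Additive.TameBranchRatCharEqPotMultHeadlines
import Summits.BirchSwinnertonDyer.Rank1Residual.Additive.TameBranchRatCharEqPotMultX3
import HarnessLib

/-!
# THE RANK-ONE HEADLINES WITHOUT THE PLUS-SYMBOL BINDER — `E`'s plus modular symbol is never
# identically zero (part 7b §1b), so `TameBranchRatCharEqAt W p` at a certified rank-one defect-2 pair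
# needs only PRINT + the first-unit-index certificate + the witness / the A′-inequality
# (cell `b2b-bsdres`, sub-cell additive-p2 = X3♯(G-ord)/X4♯(G-ord), gen 31; part 8 — hygiene)

HONEST FRAMING (cell `b2b-bsdres`, run/shared/lean/b2b/bsd-rank1-residual/, verbatim in every
file): the goal of the cell is to DELETE the COMBINATION-SHAPED residual classes of the
Birch–Swinnerton-Dyer formula for ALL analytic-rank `≤ 1` elliptic curves over `ℚ` — "full BSD
formula for every rank `≤ 1` curve in class `C`" assembled STRICTLY from published theorems — so
that the rank-`≤ 1` remainder becomes exactly the CONSTRUCTION-SHAPED classes, which are TYPED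
(missing-input `Prop`s), NOT attempted. This is not "finishing BSD". Sub-cell additive-p2: the
classes X3♯(G-ord) / X4♯(G-ord) are CONSTRUCTION-SHAPED and stay so; labels / RESIDUAL-MAP marks
UNCHANGED; nothing is booked. Theorems only (five corollaries); no definition, no named fact, no
`sorry`.

## What and why

Parts 3, 4b and 5 stated their rank-one headlines with the binder "`E`'s newform has a non-zero plus
symbol" (`∀ f, IsNewformOf W f → ∃ s, [s]⁺_f ≠ 0`), used to exclude the degenerate dictionary constant.
Part 7b §1b proved it (`exists_ratPlusSymbol_ne_zero_of_isNewformOf`: `Ω⁺_f > 0` and the cusp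
symbols generate the period lattice). THIS FILE restates the rank-one headlines without the binder:
`ClassX4Gord.tameBranchRatCharEqAt_of_katoHalf_of_firstUnit_three_rankOne'`,
`ClassX4Gord.tameBranchRatCharEqAt_of_katoHalf_of_fullSqueeze_rankOne'`,
`ClassX3Gord.tameBranchRatCharEqAt_of_wuthrichHalf_of_firstUnit_three_rankOne'`,
`ClassX3Gord.tameBranchRatCharEqAt_of_wuthrichHalf_of_fullSqueeze_rankOne'`, and part 7c's
`ClassX3M.tameBranchRatCharEqAt_of_wuthrichHalf_of_fullSqueeze_rankOne'`. So at rank one, exactly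
as at rank zero, the typed rational main conjecture at a certified defect-2 pair rests on PRINT (Kato
17.4 (3) / Wuthrich 16, Delbourgo 2002 (B), GZK, Greenberg 3.10 on the parity route) plus FINITE DATA
and — for the readings — the identification of the engine height with Delbourgo's regulator (the
inequality `v ≤ ord_p Reg_p(E,Dh)` is stated for the (B)-datum). Nothing booked; labels UNCHANGED.

References: [Kato2004Asterisque] Thm. 17.4 (3); [Wuthrich2014] Thm. 16; [Delbourgo2002] Thm. (B);
[GreenbergLNM1716] Prop. 3.10, §4; [CremonaAlgorithms1997] §2.8; parts 3, 4b, 5, 7b, 7c of gen 31. -/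

set_option autoImplicit false

noncomputable section

open scoped Classical MatrixGroups ModularForm NumberField

open CongruenceSubgroup IsDedekindDomain WeierstrassCurve NumberField
  Literature.NumberTheory.EllipticCurves
  Literature.NumberTheory.EllipticCurves.ModularForms
  Literature.NumberTheory.EllipticCurves.Rank1Residual
  Literature.NumberTheory.EllipticCurves.Rank1Residual.Typed
  Literature.NumberTheory.EllipticCurves.Delbourgo2002
  Literature.NumberTheory.EllipticCurves.Greenberg1999
  Literature.NumberTheory.GaloisRepresentations
  Summit.BirchSwinnertonDyer.Rank1Residual.AdditivePotMult
  Summit.BirchSwinnertonDyer.Rank1Residual.X1.MuLambda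
  Summit.BirchSwinnertonDyer.Rank1Residual.X1.RankOneParitySqueeze
  Summit.BirchSwinnertonDyer.Rank1Residual.X11a.LambdaNorm

namespace Summit.BirchSwinnertonDyer.Rank1Residual.Additive

/-! ### §5 The rank-one headlines, binder-free -/

section BinderFree

open TameBranchMuPart

variable {W : WeierstrassCurve ℚ} [W.IsElliptic] [W.IsGloballyMinimal] {p : ℕ} [hp : Fact p.Prime]

/-- **Part 4b's rank-one headline WITHOUT the plus-symbol binder**: X4♯(G-ord) ∩ `I₀*` ∩ {`ρ̄` onto},
`p ≥ 5`, `r_an = 1`, a (B)-datum; first unit index `3`, `[T¹](ϖ·B^±) ≠ 0`, `1 + 2·ord_p #tors < v + ord_p ∏c`,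
`v ≤ ord_p Reg_p(E,Dh)` ⟹ **`TameBranchRatCharEqAt W p`**, `μ = 0`, `λ = 3`.
[cite: Kato2004Asterisque, Thm. 17.4 (3) (p. 273)] [cite: Delbourgo2002, Theorem (B) (p. 40)]
[cite: GreenbergLNM1716, Prop. 3.10 and §5 p. 183] [cite: CremonaAlgorithms1997, §2.8] -/
theorem ClassX4Gord.tameBranchRatCharEqAt_of_katoHalf_of_firstUnit_three_rankOne'
    (hK : Wuthrich2014.kato_halfEigenCharIdeal_dvd_cyclotomicPrime_of_surjective)
    (hmodD : nonempty_modularParametrizationData)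
    (hGZK : rank_eq_analyticRank_of_analyticRank_le_one)
    (h310 : prop310_selmerCorank_mod_two_eq_lambdaInvariant)
    (hX : ClassX4Gord W p) (hp5 : 5 ≤ p) (he : semistabilityIndex W p = 2) (hsurj : Surj W p)
    (hr : W.analyticRank = 1) {Dh : PAdicHeightData W p} (hBcl : LeadingTermClauses W p Dh)
    (hcert : ∀ (V : WeierstrassCurve ℚ) [V.IsElliptic] [V.IsGloballyMinimal] (C : VariableChange ℚ),
      C • V.quadraticTwist ((-1 : ℚ) ^ (p / 2) * p) = W → IsOrdinaryAt V p →
      ∀ {N : ℕ} [NeZero N] (f : CuspForm (Gamma0 N) 2), IsNewformOf V f →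
      ∀ ϖ : ℚ, (if Even (p / 2) then (ϖ : ℝ) * V.realPeriodRat = plusPeriod f
          else (ϖ : ℝ) * V.imaginaryPeriodRat = minusPeriod f) →
        PowerSeries.coeff 1 (PowerSeries.C (ϖ : ℚ_[p]) *
            (if Even (p / 2) then padicLFunctionBranch f ((unitRoot V p : ℤ_[p]) : ℚ_[p]) (p / 2)
              else padicLFunctionMinusBranch f ((unitRoot V p : ℤ_[p]) : ℚ_[p]) (p / 2))) ≠ 0 ∧
        ‖PowerSeries.coeff 3 (PowerSeries.C (ϖ : ℚ_[p]) *
            (if Even (p / 2) then padicLFunctionBranch f ((unitRoot V p : ℤ_[p]) : ℚ_[p]) (p / 2)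
              else padicLFunctionMinusBranch f ((unitRoot V p : ℤ_[p]) : ℚ_[p]) (p / 2)))‖ = 1 ∧
        ∀ i < 3, ‖PowerSeries.coeff i (PowerSeries.C (ϖ : ℚ_[p]) *
            (if Even (p / 2) then padicLFunctionBranch f ((unitRoot V p : ℤ_[p]) : ℚ_[p]) (p / 2)
              else padicLFunctionMinusBranch f ((unitRoot V p : ℤ_[p]) : ℚ_[p]) (p / 2)))‖ < 1)
    {v : ℤ} (hv : v ≤ (padicRegulator Dh).valuation)
    (hb : (1 : ℤ) + 2 * padicValNat p W.torsionOrder < v + padicValNat p W.tamagawaProduct) :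
    TameBranchRatCharEqAt W p ∧
      ∀ (κ : ZpExtension ℚ p) (γ : Field.absoluteGaloisGroup ℚ),
        κ.IsCyclotomic → κ.IsTopGenerator γ → IsCyclotomicVariable p γ →
        ∀ (D : W.SelmerDualData κ γ) (fE : IwasawaAlgebra p), D.charIdeal = Ideal.span {fE} →
          mu fE = 0 ∧ lam fE = 3 :=
  ClassX4Gord.tameBranchRatCharEqAt_of_katoHalf_of_firstUnit_three_rankOne hK hmodD hGZK h310 hX hp5
    he hsurj hr hBcl (fun _ hf ↦ exists_ratPlusSymbol_ne_zero_of_isNewformOf hf) hcert hv hb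


/-- **Part 3's rank-one full-route headline WITHOUT the plus-symbol binder**: X4♯(G-ord) ∩ `I₀*` ∩
{`ρ̄` onto}, `p ≥ 5`, `r_an = 1`, a (B)-datum; `[T¹](ϖ·B^±) ≠ 0`,
`v_p([T¹](ϖ·B^±)) + 1 + 2·ord_p #tors ≤ v + ord_p ∏c`, first unit index `n`, `v ≤ ord_p Reg_p(E,Dh)` ⟹
**`TameBranchRatCharEqAt W p`**, Schneider, `ord_p Reg_p = v`, `#Ш[p^∞] = 1`, `μ = 0`, `λ = n` — from Kato
17.4 (3), (B), GZK and the finite data ALONE. [cite: Kato2004Asterisque, Thm. 17.4 (3) (p. 273)]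
[cite: Delbourgo2002, Theorem (B) (p. 40)] [cite: GreenbergLNM1716, §4 pp. 102–110] [cite: CremonaAlgorithms1997, §2.8] -/
theorem ClassX4Gord.tameBranchRatCharEqAt_of_katoHalf_of_fullSqueeze_rankOne'
    (hK : Wuthrich2014.kato_halfEigenCharIdeal_dvd_cyclotomicPrime_of_surjective)
    (hmodD : nonempty_modularParametrizationData)
    (hGZK : rank_eq_analyticRank_of_analyticRank_le_one)
    (hX : ClassX4Gord W p) (hp5 : 5 ≤ p) (he : semistabilityIndex W p = 2) (hsurj : Surj W p)
    (hr : W.analyticRank = 1) {Dh : PAdicHeightData W p} (hBcl : LeadingTermClauses W p Dh)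
    {n : ℕ} {v : ℤ} (hv : v ≤ (padicRegulator Dh).valuation)
    (hcert : ∀ (V : WeierstrassCurve ℚ) [V.IsElliptic] [V.IsGloballyMinimal] (C : VariableChange ℚ),
      C • V.quadraticTwist ((-1 : ℚ) ^ (p / 2) * p) = W → IsOrdinaryAt V p →
      ∀ {N : ℕ} [NeZero N] (f : CuspForm (Gamma0 N) 2), IsNewformOf V f →
      ∀ ϖ : ℚ, (if Even (p / 2) then (ϖ : ℝ) * V.realPeriodRat = plusPeriod f
          else (ϖ : ℝ) * V.imaginaryPeriodRat = minusPeriod f) →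
        PowerSeries.coeff 1 (PowerSeries.C (ϖ : ℚ_[p]) *
            (if Even (p / 2) then padicLFunctionBranch f ((unitRoot V p : ℤ_[p]) : ℚ_[p]) (p / 2)
              else padicLFunctionMinusBranch f ((unitRoot V p : ℤ_[p]) : ℚ_[p]) (p / 2))) ≠ 0 ∧
        (PowerSeries.coeff 1 (PowerSeries.C (ϖ : ℚ_[p]) *
            (if Even (p / 2) then padicLFunctionBranch f ((unitRoot V p : ℤ_[p]) : ℚ_[p]) (p / 2)
              else padicLFunctionMinusBranch f ((unitRoot V p : ℤ_[p]) : ℚ_[p]) (p / 2)))).valuation +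
            1 + 2 * padicValNat p W.torsionOrder ≤ v + padicValNat p W.tamagawaProduct ∧
        ‖PowerSeries.coeff n (PowerSeries.C (ϖ : ℚ_[p]) *
            (if Even (p / 2) then padicLFunctionBranch f ((unitRoot V p : ℤ_[p]) : ℚ_[p]) (p / 2)
              else padicLFunctionMinusBranch f ((unitRoot V p : ℤ_[p]) : ℚ_[p]) (p / 2)))‖ = 1 ∧
        ∀ i < n, ‖PowerSeries.coeff i (PowerSeries.C (ϖ : ℚ_[p]) *
            (if Even (p / 2) then padicLFunctionBranch f ((unitRoot V p : ℤ_[p]) : ℚ_[p]) (p / 2)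
              else padicLFunctionMinusBranch f ((unitRoot V p : ℤ_[p]) : ℚ_[p]) (p / 2)))‖ < 1) :
    TameBranchRatCharEqAt W p ∧ SchneiderConjecture Dh ∧ (padicRegulator Dh).valuation = v ∧
      Nat.card (AddCommGroup.primaryComponent W.sha p) = 1 ∧
      ∀ (κ : ZpExtension ℚ p) (γ : Field.absoluteGaloisGroup ℚ),
        κ.IsCyclotomic → κ.IsTopGenerator γ → IsCyclotomicVariable p γ →
        ∀ (D : W.SelmerDualData κ γ) (fE : IwasawaAlgebra p), D.charIdeal = Ideal.span {fE} →
          mu fE = 0 ∧ lam fE = n :=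
  ClassX4Gord.tameBranchRatCharEqAt_of_katoHalf_of_fullSqueeze_rankOne hK hmodD hGZK hX hp5 he hsurj
    hr hBcl (fun _ hf ↦ exists_ratPlusSymbol_ne_zero_of_isNewformOf hf) hv hcert


/-- **Part 5's X3 rank-one parity headline WITHOUT the plus-symbol binder** (Wuthrich Thm 16, every odd
`p`, (B)-datum a binder). [cite: Wuthrich2014, Thm. 16 (p. 397)] [cite: Delbourgo2002, Theorem (B) (p. 40)]
[cite: GreenbergLNM1716, Prop. 3.10 and §5 p. 183] [cite: CremonaAlgorithms1997, §2.8] -/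
theorem ClassX3Gord.tameBranchRatCharEqAt_of_wuthrichHalf_of_firstUnit_three_rankOne'
    (hWu : Wuthrich2014.thm16_halfEigenCharIdeal_dvd_cyclotomicPrime)
    (hmodD : nonempty_modularParametrizationData)
    (hGZK : rank_eq_analyticRank_of_analyticRank_le_one)
    (h310 : prop310_selmerCorank_mod_two_eq_lambdaInvariant)
    (hX : ClassX3Gord W p) (hp2 : p ≠ 2) (he : semistabilityIndex W p = 2)
    (hr : W.analyticRank = 1) {Dh : PAdicHeightData W p} (hBcl : LeadingTermClauses W p Dh)
    (hcert : ∀ (V : WeierstrassCurve ℚ) [V.IsElliptic] [V.IsGloballyMinimal] (C : VariableChange ℚ),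
      C • V.quadraticTwist ((-1 : ℚ) ^ (p / 2) * p) = W → IsOrdinaryAt V p →
      ∀ {N : ℕ} [NeZero N] (f : CuspForm (Gamma0 N) 2), IsNewformOf V f →
      ∀ ϖ : ℚ, (if Even (p / 2) then (ϖ : ℝ) * V.realPeriodRat = plusPeriod f
          else (ϖ : ℝ) * V.imaginaryPeriodRat = minusPeriod f) →
        PowerSeries.coeff 1 (PowerSeries.C (ϖ : ℚ_[p]) *
            (if Even (p / 2) then padicLFunctionBranch f ((unitRoot V p : ℤ_[p]) : ℚ_[p]) (p / 2)
              else padicLFunctionMinusBranch f ((unitRoot V p : ℤ_[p]) : ℚ_[p]) (p / 2))) ≠ 0 ∧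
        ‖PowerSeries.coeff 3 (PowerSeries.C (ϖ : ℚ_[p]) *
            (if Even (p / 2) then padicLFunctionBranch f ((unitRoot V p : ℤ_[p]) : ℚ_[p]) (p / 2)
              else padicLFunctionMinusBranch f ((unitRoot V p : ℤ_[p]) : ℚ_[p]) (p / 2)))‖ = 1 ∧
        ∀ i < 3, ‖PowerSeries.coeff i (PowerSeries.C (ϖ : ℚ_[p]) *
            (if Even (p / 2) then padicLFunctionBranch f ((unitRoot V p : ℤ_[p]) : ℚ_[p]) (p / 2)
              else padicLFunctionMinusBranch f ((unitRoot V p : ℤ_[p]) : ℚ_[p]) (p / 2)))‖ < 1)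
    {v : ℤ} (hv : v ≤ (padicRegulator Dh).valuation)
    (hb : (1 : ℤ) + 2 * padicValNat p W.torsionOrder < v + padicValNat p W.tamagawaProduct) :
    TameBranchRatCharEqAt W p ∧
      ∀ (κ : ZpExtension ℚ p) (γ : Field.absoluteGaloisGroup ℚ),
        κ.IsCyclotomic → κ.IsTopGenerator γ → IsCyclotomicVariable p γ →
        ∀ (D : W.SelmerDualData κ γ) (fE : IwasawaAlgebra p), D.charIdeal = Ideal.span {fE} →
          mu fE = 0 ∧ lam fE = 3 :=
  ClassX3Gord.tameBranchRatCharEqAt_of_wuthrichHalf_of_firstUnit_three_rankOne hWu hmodD hGZK h310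
    hX hp2 he hr hBcl (fun _ hf ↦ exists_ratPlusSymbol_ne_zero_of_isNewformOf hf) hcert hv hb


/-- **Part 5's X3 rank-one full-route headline WITHOUT the plus-symbol binder** (Wuthrich Thm 16, every
odd `p`, (B)-datum a binder; NO parity). [cite: Wuthrich2014, Thm. 16 (p. 397)]
[cite: Delbourgo2002, Theorem (B) (p. 40)] [cite: GreenbergLNM1716, §4 pp. 102–110] [cite: CremonaAlgorithms1997, §2.8] -/
theorem ClassX3Gord.tameBranchRatCharEqAt_of_wuthrichHalf_of_fullSqueeze_rankOne'
    (hWu : Wuthrich2014.thm16_halfEigenCharIdeal_dvd_cyclotomicPrime)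
    (hmodD : nonempty_modularParametrizationData)
    (hGZK : rank_eq_analyticRank_of_analyticRank_le_one)
    (hX : ClassX3Gord W p) (hp2 : p ≠ 2) (he : semistabilityIndex W p = 2)
    (hr : W.analyticRank = 1) {Dh : PAdicHeightData W p} (hBcl : LeadingTermClauses W p Dh)
    {n : ℕ} {v : ℤ} (hv : v ≤ (padicRegulator Dh).valuation)
    (hcert : ∀ (V : WeierstrassCurve ℚ) [V.IsElliptic] [V.IsGloballyMinimal] (C : VariableChange ℚ),
      C • V.quadraticTwist ((-1 : ℚ) ^ (p / 2) * p) = W → IsOrdinaryAt V p →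
      ∀ {N : ℕ} [NeZero N] (f : CuspForm (Gamma0 N) 2), IsNewformOf V f →
      ∀ ϖ : ℚ, (if Even (p / 2) then (ϖ : ℝ) * V.realPeriodRat = plusPeriod f
          else (ϖ : ℝ) * V.imaginaryPeriodRat = minusPeriod f) →
        PowerSeries.coeff 1 (PowerSeries.C (ϖ : ℚ_[p]) *
            (if Even (p / 2) then padicLFunctionBranch f ((unitRoot V p : ℤ_[p]) : ℚ_[p]) (p / 2)
              else padicLFunctionMinusBranch f ((unitRoot V p : ℤ_[p]) : ℚ_[p]) (p / 2))) ≠ 0 ∧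
        (PowerSeries.coeff 1 (PowerSeries.C (ϖ : ℚ_[p]) *
            (if Even (p / 2) then padicLFunctionBranch f ((unitRoot V p : ℤ_[p]) : ℚ_[p]) (p / 2)
              else padicLFunctionMinusBranch f ((unitRoot V p : ℤ_[p]) : ℚ_[p]) (p / 2)))).valuation +
            1 + 2 * padicValNat p W.torsionOrder ≤ v + padicValNat p W.tamagawaProduct ∧
        ‖PowerSeries.coeff n (PowerSeries.C (ϖ : ℚ_[p]) *
            (if Even (p / 2) then padicLFunctionBranch f ((unitRoot V p : ℤ_[p]) : ℚ_[p]) (p / 2)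
              else padicLFunctionMinusBranch f ((unitRoot V p : ℤ_[p]) : ℚ_[p]) (p / 2)))‖ = 1 ∧
        ∀ i < n, ‖PowerSeries.coeff i (PowerSeries.C (ϖ : ℚ_[p]) *
            (if Even (p / 2) then padicLFunctionBranch f ((unitRoot V p : ℤ_[p]) : ℚ_[p]) (p / 2)
              else padicLFunctionMinusBranch f ((unitRoot V p : ℤ_[p]) : ℚ_[p]) (p / 2)))‖ < 1) :
    TameBranchRatCharEqAt W p ∧ SchneiderConjecture Dh ∧ (padicRegulator Dh).valuation = v ∧
      Nat.card (AddCommGroup.primaryComponent W.sha p) = 1 ∧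
      ∀ (κ : ZpExtension ℚ p) (γ : Field.absoluteGaloisGroup ℚ),
        κ.IsCyclotomic → κ.IsTopGenerator γ → IsCyclotomicVariable p γ →
        ∀ (D : W.SelmerDualData κ γ) (fE : IwasawaAlgebra p), D.charIdeal = Ideal.span {fE} →
          mu fE = 0 ∧ lam fE = n :=
  ClassX3Gord.tameBranchRatCharEqAt_of_wuthrichHalf_of_fullSqueeze_rankOne hWu hmodD hGZK hX hp2 he
    hr hBcl (fun _ hf ↦ exists_ratPlusSymbol_ne_zero_of_isNewformOf hf) hv hcert

/-- **Part 7c's X3♯(M) rank-one full-route headline WITHOUT the plus-symbol binder** (Wuthrich Thm 16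
via the AdditivePotMult brick, every odd `p`, (B)-datum a binder; NO parity).
[cite: Wuthrich2014, Thm. 16 (p. 397)] [cite: Delbourgo2002, Theorem (B) (p. 40), p. 39]
[cite: GreenbergLNM1716, §4 pp. 102–110] [cite: CremonaAlgorithms1997, §2.8] -/
theorem ClassX3M.tameBranchRatCharEqAt_of_wuthrichHalf_of_fullSqueeze_rankOne'
    (hWu : Wuthrich2014.thm16_halfEigenCharIdeal_dvd_cyclotomicPrime)
    (hmodD : nonempty_modularParametrizationData)
    (hGZK : rank_eq_analyticRank_of_analyticRank_le_one)
    (hX : ClassX3M W p) (hr : W.analyticRank = 1)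
    {Dh : PAdicHeightData W p} (hBcl : LeadingTermClauses W p Dh)
    {n : ℕ} {v : ℤ} (hv : v ≤ (padicRegulator Dh).valuation)
    (hcert : ∀ (V : WeierstrassCurve ℚ) [V.IsElliptic] [V.IsGloballyMinimal] (C : VariableChange ℚ),
      Mult V p → C • V.quadraticTwist ((-1 : ℚ) ^ (p / 2) * p) = W →
      ∀ {N : ℕ} [NeZero N] (f : CuspForm (Gamma0 N) 2), IsNewformOf V f → ∀ (ap : ℤ), cuspCoeff f p = ap →
      ∀ ϖ : ℚ, (if Even (p / 2) then (ϖ : ℝ) * V.realPeriodRat = plusPeriod f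
          else (ϖ : ℝ) * V.imaginaryPeriodRat = minusPeriod f) →
        PowerSeries.coeff 1 (PowerSeries.C (ϖ : ℚ_[p]) *
            (if Even (p / 2) then padicLFunctionPlusBranchMult f ((ap : ℤ) : ℚ_[p]) (p / 2)
              else padicLFunctionMinusBranchMult f ((ap : ℤ) : ℚ_[p]) (p / 2))) ≠ 0 ∧
        (PowerSeries.coeff 1 (PowerSeries.C (ϖ : ℚ_[p]) *
            (if Even (p / 2) then padicLFunctionPlusBranchMult f ((ap : ℤ) : ℚ_[p]) (p / 2)
              else padicLFunctionMinusBranchMult f ((ap : ℤ) : ℚ_[p]) (p / 2)))).valuation +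
            1 + 2 * padicValNat p W.torsionOrder ≤ v + padicValNat p W.tamagawaProduct ∧
        ‖PowerSeries.coeff n (PowerSeries.C (ϖ : ℚ_[p]) *
            (if Even (p / 2) then padicLFunctionPlusBranchMult f ((ap : ℤ) : ℚ_[p]) (p / 2)
              else padicLFunctionMinusBranchMult f ((ap : ℤ) : ℚ_[p]) (p / 2)))‖ = 1 ∧
        ∀ i < n, ‖PowerSeries.coeff i (PowerSeries.C (ϖ : ℚ_[p]) *
            (if Even (p / 2) then padicLFunctionPlusBranchMult f ((ap : ℤ) : ℚ_[p]) (p / 2)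
              else padicLFunctionMinusBranchMult f ((ap : ℤ) : ℚ_[p]) (p / 2)))‖ < 1) :
    TameBranchRatCharEqAt W p ∧ SchneiderConjecture Dh ∧ (padicRegulator Dh).valuation = v ∧
      Nat.card (AddCommGroup.primaryComponent W.sha p) = 1 ∧
      ∀ (κ : ZpExtension ℚ p) (γ : Field.absoluteGaloisGroup ℚ),
        κ.IsCyclotomic → κ.IsTopGenerator γ → IsCyclotomicVariable p γ →
        ∀ (D : W.SelmerDualData κ γ) (fE : IwasawaAlgebra p), D.charIdeal = Ideal.span {fE} →
          mu fE = 0 ∧ lam fE = n :=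
  ClassX3M.tameBranchRatCharEqAt_of_wuthrichHalf_of_fullSqueeze_rankOne hWu hmodD hGZK hX hr hBcl
    (fun _ hf ↦ exists_ratPlusSymbol_ne_zero_of_isNewformOf hf) hv hcert

end BinderFree

end Summit.BirchSwinnertonDyer.Rank1Residual.Additive

end
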